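import Literature.MathematicalPhysics.QuantumFieldTheory.Balaban1983to89.B9B8KnitBondGpLettersAtPars
import Literature.MathematicalPhysics.QuantumFieldTheory.Balaban1983to89.B9B8KnitVsTaxicabReg335

/-!
# `Balaban1983to89.B9B8KnitLetterTransferReg335` — T. Bałaban, *Propagators for lattice gauge theories in a background field*, Commun. Math. Phys. **99**
# (1985) 389–434 [Balaban1985BackgroundPropagators], Thm 3.1 (3.42)₁,₂ p. 397 AT PRINT's KNIT LETTER `parKnitY` ((3.19) p. 393, «(52), (53) in [5]») FOR
# EVERY MEMBER OF THE LOCAL CLASS (3.35) p. 396 — cell `lit-balaban`'s junction J-B files 8 ∕ 9 ∕ 10 (`B9B8KnitLetterResolvent` §3, `…MajorantTransfer`,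
# `…EntriesTransfer`) WITHOUT [5]'s GLOBAL small-field binder (52): the block-diagonal letter `E = Δ′_a(U; parSymY) − Δ′_a(U; parKnitY)` carries the
# LEVEL WEIGHT `ℓ(a)⁻²` on (3.35), and every transfer goes through with the SAME output shapes

statement-level skeleton of published theorems with citation tags; proofs where landed; nothing here is a claim about the Yang–Mills mass gap

THE PRINT.  [B9] (3.19) p. 393 (print's site averaging carries the composite-contour transporters «defined by (52), (53) in [5]» — the tree's `parKnitY`;
def-Y's letter of record `parSymY` is the tree's taxicab reading); (3.24) p. 394 (`Δ′_a(U) = −Δ_U + Σ_j a_j(Lʲη)⁻²Q′_j*Q′_j`); (3.35) p. 396 (the LOCAL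
class: «|A| < O(1)Mα₀(Lʲη)⁻¹, |∇^ηA| < O(1)Mα₀(Lʲη)⁻² on □» for a cube of index `j`); Thm 3.1 (3.42) p. 397; Thm 3.7 (3.90) pp. 409–410 («G′ = G′₀(I − R′)⁻¹ … convergent
in all norms»); [4] = *Propagators and renormalization transformations II*, CMP **96** (1984), Prop. 2.2 (2.50)–(2.52) p. 232, Lemma 2.1 (2.60)–(2.61) p. 234,
(2.66)–(2.67) p. 234; [5] = *Averaging operations for lattice gauge theories*, CMP **98** (1985), (44) p. 24, (52)–(53) pp. 26–27.

WHY THIS FILE (cell `pub-ymgap`, node N06, seat `dag-n06-j` gen 36 = bundle F5 row 17; lit-balaban lead g41 DESK PRE-LOCATION 2026-08-30 «the re-pin of ASM2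
at parKnitY itself is lane work»).  The N06 certificate's row 17 at the knit record (`B9Thm311PosDefQknitAtKnitSiteTableY`) displays ONE law: Thm 3.3's block for
`Δ_a(U; parKnitY)` on (3.35).  The cell `lit-balaban` junction J-B transfers every letter from `parSymY` to `parKnitY` under [5]'s GLOBAL (52)
`pdev (liftCfg U) < α₀′(Lᵏ)⁻²`, which a multi-level member of (3.35) does NOT satisfy (in `Λ_j`-territory the plaquettes are only `≲ K_pl(Mα₀)L⁴·(Lʲ)⁻²`).  Seat
`dag-n06-l` re-read the two LOCAL inputs of the junction on (3.35) by retraction to the block box: the knit legs are `U(N)`-valued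
(`B9Eq3124HZKnitPairReg335Y.parKnitY_mem_unitary_of_reg335P`) and the corner pair differs by `8(d+1)²α₀′` LEVEL-FREE
(`B9B8KnitVsTaxicabReg335.norm_parKnitY_sub_parSymY_le_of_reg335P`).  THIS FILE runs J-B files 8 §3, 9, 10 and the `Q′`-difference letters of file 23a on
these two inputs.  THE ONE CHANGE: on (3.35) the block bound of `E` at a block of level `j` is `32(d+1)²α₀′·a_j(Lʲ)⁻²` (not `(Lᵏ)⁻²`), so the realified letter
`conj b(η⁻²E)` has the WEIGHTED diagonal majorant `θ_E·ℓ(a)⁻²·𝟙[a = a′]` (`ℓ(a) = Lʲ∕Lᵏ`, `θ_E = 32(d+1)²α₀′M₂Σ‖b_j‖`); since every use of `E` is a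
product with a `G′`-letter `≺ A·ℓ²·e^{−δd}` evaluated AT THE SAME POINT, the weight cancels exactly and every output of files 9 ∕ 10 keeps its shape and constant.

WHAT IS PROVED (sorry-free; 0 `def`; no estimate of the papers beyond the landed ones).
* §0 `len_sec_blkOf` (`ℓ(ιB(Δ z)) = L^{j(Δ z)}∕|c_f|` for a section `ιB`), `weight_eq_inv_len_sq` (print's units: `(η²)⁻¹(Lʲ)⁻² = ℓ(a)⁻²`).
* §1 ★★ `norm_deltaPrimeAY_sub_apply_le_of_reg335P` — `‖(EΛ)(z)‖ ≤ 32(d+1)²α₀′·(L^{j(z)})⁻²·M` on (3.35) (file 8's `norm_sub_apply_le_of_blk` at n06-l's `δ`).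
* §2 ★★ `hasMajorant_conj_smul_sub_reg335` ∕ `hasMajorant_conj_E_reg335` — the weighted diagonal majorants of `conj b(η⁻²(Δ′_S − Δ′_K))` and of its negative.
* §3 ★★★ `hasMajorant_conj_GpY_parKnitY_of_parSymY_reg335` — Thm 3.1 (3.42)₁ at the knit letter on (3.35): `conj b(η²G′(U; parKnitY)) ≺ Ac₁(α)(1 − θc₁(α))⁻¹·ℓ(a)²·
  e^{−(1−α)δ₀d}`, `θ = θ_E·A` — file 9's `_len` output VERBATIM, its (52) binder replaced by `U ∈ (bg9KP …).Reg335 c₀ α₀` + the x-free knit numerics.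
* §4 ★★★ `hasMajorant_left_conj_GpY_parKnitY_of_parSymY_reg335` — Thm 3.1 (3.42)₂,₄ (any real-coordinate left factor) at the knit letter on (3.35), file 10's
  `_len` output VERBATIM.
HONEST SCOPE.  Re-reading of landed estimates through n06-l's two local lemmas; the displayed (3.42) majorants at `parSymY` stay hypotheses (suppliers: M5.5 ∕
FILE 9 at the member); helper, count-neutral; N06 NOT discharged; nothing continuum ∕ OS ∕ mass gap ∕ Clay — the Yang–Mills mass gap is NOT proved here.
No `sorry`, no `axiom`, no `instance`, no `notation`, no `def`.  NEW file; nothing landed is modified.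
RELATED, NOT DUPLICATED (searched 2026-08-30: `rg -l "TransferReg335|of_parSymY_reg335"` over `lean/Literature` = ∅): J-B files 8–10 (the (52) originals,
USED BY NAME for the algebra: `norm_sub_apply_le_of_blk`, `conj_fixedPoint`, `left_conj_identity`, `sum_ite_eq_mul`), n06-l's `B9B8KnitVsTaxicabReg335`,
`B9Eq3124HZKnitPairReg335Y` (the two local inputs, USED BY NAME), `B9B8KnitLetterCoerciveReg335` (the `L²` coercivity at the knit letter on (3.35) — a different
norm).
-/

noncomputable section

namespace Literature.MathematicalPhysics.QuantumFieldTheory.Balaban1983to89.B9B8KnitLetterTransferReg335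

open Node00 B6KLevelCensusIndexV1 B6Geom246MultiLevelBox B9BackgroundsKLevelV1 B9Eq39Adjoint B9Thm311ReadingCoords B9Thm311DeltaPrimePos
open B6RandomWalk (HasMajorant Triangle254 Ineq261 Ineq263 hasMajorant_mono hasMajorant_mul hasMajorant_add majorant_of_fixedPoint_266 majorant_G0_mul_265
  c1_nonneg)
open B6Ineq2142KLevelV1 (β lvl beta_level)
open B9Thm34Ext (toB6 toB6_dist)
open B9GeoNormsKLevelV1 (geo9K geo9K_len_kGeo geo9K_dist_nonneg)
open B9GeoLemma21KLevelV1 (geo9K_len_pos)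
open B9Eq352DivFormLetters (coordEquiv conj conj_apply conj_neg hasMajorant_conj_of_local')
open B9Cor35GpCubeInputsAtOne (hasMajorant_neg)
open B9Ineq349SiteComposite (etaS_pos)
open B7Prop1Explicit (U1 mem_U1)
open B7Prop2Explicit (C0 c2' unitaryUnits unitaryUnits_le_U1)
open B9B8AveragingJunction (parKnitY parKnitY_inv levY_of_blkOf)
open B6MultiLevelBoxOperator (aPrinted)
open B9B8KnitLetterResolvent (norm_sub_apply_le_of_blk)
open B9B8KnitLetterCoercive (contraction_of_mem_unitary)
open B9B8KnitLetterMajorantTransfer (conj_fixedPoint sum_ite_eq_mul inv_etaS_sq_mul geo9K_len_sq_le_one)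
open B9B8KnitLetterEntriesTransfer (left_conj_identity)
open B9B8KnitVsTaxicabReg335 (norm_parKnitY_sub_parSymY_le_of_reg335P)
open B9Eq3124HZKnitPairReg335Y (parKnitY_mem_unitary_of_reg335P)
open B9BackgroundsKLevelV1P (bg9KP mem_of_reg335P)
open B9C2FormBoxRegimeY (Kpl)
open scoped Matrix Matrix.Norms.L2Operator

variable {d ℓ : ℕ} {hd : 1 ≤ d + 1} {hL : Odd (ℓ + 1) ∧ 1 < ℓ + 1} {b₀ b₁ : ℝ}
variable (i : KIdx d ℓ hd hL b₀ b₁) {N : ℕ} {G : Subgroup (Matrix (Fin N) (Fin N) ℂ)ˣ}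
variable {ι : Type} [Fintype ι] [DecidableEq ι] (b : Module.Basis ι ℝ (Matrix (Fin N) (Fin N) ℂ))
variable [Fintype (geo9K i).Site] [DecidableEq (geo9K i).Site] {Rr : ℝ} {Hp : Prop} (ιB : BlkY i → IBondY i)

/-! ## §0 The level weight at a section -/

omit [Fintype (geo9K i).Site] [DecidableEq (geo9K i).Site] in
/-- for a section `ιB` of `β`, the block scale read at `ιB(s)` is `L^{j(s)}∕|c_f|`. [cite: Balaban1984PropagatorsII, (2.45) p.231 + (2.1) p.224, dictionary] -/
theorem len_sec (hι : ∀ s, β i.hN i.D i.hk (ιB s) = s) (s : BlkY i) :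
    (geo9K i).len (ιB s) = (((ℓ + 1 : ℕ) : ℝ)) ^ s.1.1 / |i.cf| := by
  rw [geo9K_len_kGeo, len_eq]
  have hk1 : 1 ≤ i.k := le_trans (by norm_num) i.hk2
  have h := beta_level i.hN i.D i.hk hk1 (ιB s)
  rw [hι] at h
  rw [← h]

omit [Fintype (geo9K i).Site] [DecidableEq (geo9K i).Site] in
/-- print's units `c_f = Lᵏ`, `η = L^{−k}`: `(η²)⁻¹·(Lʲ)⁻² = ℓ(ιB s)⁻²` at a block `s` of level `j`. [cite: Balaban1984PropagatorsII, (2.1) p.224, (2.45) p.231, bookkeeping] -/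
theorem weight_eq_inv_len_sq (hι : ∀ s, β i.hN i.D i.hk (ιB s) = s) (hcf : i.cf = (((ℓ + 1 : ℕ) : ℝ)) ^ i.k) (s : BlkY i) :
    (etaS i ^ 2)⁻¹ * ((((ℓ + 1) ^ s.1.1 : ℕ) : ℝ) ^ 2)⁻¹ = ((geo9K i).len (ιB s) ^ 2)⁻¹ := by
  rw [len_sec i ιB hι s, hcf]
  have hL0 : (0 : ℝ) < ((ℓ + 1 : ℕ) : ℝ) := by exact_mod_cast Nat.succ_pos ℓ
  have hpos : (0 : ℝ) < (((ℓ + 1 : ℕ) : ℝ)) ^ i.k := by positivity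
  have hne : ((((ℓ + 1) ^ i.k : ℕ) : ℝ)) ^ 2 ≠ 0 := by positivity
  have hη : (etaS i ^ 2)⁻¹ = ((((ℓ + 1) ^ i.k : ℕ) : ℝ)) ^ 2 := (mul_inv_eq_one₀ hne).1 (inv_etaS_sq_mul i)
  rw [hη, abs_of_pos hpos]
  have hj : (0 : ℝ) < (((ℓ + 1 : ℕ) : ℝ)) ^ s.1.1 := by positivity
  push_cast
  field_simp

/-! ## §1 `E` on the class (3.35): the block bound with the level weight -/

omit [Fintype ι] [DecidableEq ι] [Fintype (geo9K i).Site] [DecidableEq (geo9K i).Site] in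
/-- ★★ **`E = Δ′_a(U; parSymY) − Δ′_a(U; parKnitY)` ON THE LOCAL CLASS (3.35)**: for `G ≤ U(N)` (`|u| ≤ 1` on `G`), `c₀ ≤ 10`, `0 ≤ Mα₀`,
`U ∈ (bg9KP … G i).Reg335 c₀ α₀`, the x-free knit numerics `0 < α₀′`, `C₀α₀′ ≤ ⅓`, `2α₀′ ≤ c₂′`, `K_pl(Mα₀)·L⁴ < α₀′`, and `‖Λ w‖ ≤ M` (`M ≥ 0`) on the block of
`z` (level `j(z)`): `‖(EΛ)(z)‖ ≤ 32(d+1)²α₀′·(L^{j(z)})⁻²·M` — file 8's `norm_sub_apply_le_of_blk` at n06-l's LEVEL-FREE corner defect `8(d+1)²α₀′`.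
[cite: Balaban1985BackgroundPropagators, (3.24) p.394, (3.19) p.393, (3.35) p.396; Balaban1985Averaging, (44) p.24, (52)–(53) pp.26–27; Balaban1984PropagatorsII, (2.14) p.225] -/
theorem norm_deltaPrimeAY_sub_apply_le_of_reg335P [Nonempty (Fin N)]
    (hG1 : ∀ u : (Matrix (Fin N) (Fin N) ℂ)ˣ, u ∈ G → ‖(u : Matrix (Fin N) (Fin N) ℂ)‖ ≤ 1) (hGU : G ≤ unitaryUnits (Matrix (Fin N) (Fin N) ℂ))
    {U : CfgY (Matrix (Fin N) (Fin N) ℂ) i} {c₀ α₀ : ℝ} (hc : c₀ ≤ 10) (hMα : 0 ≤ (kGeo i).M * α₀)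
    (hreg : (bg9KP (Matrix (Fin N) (Fin N) ℂ) G i).Reg335 c₀ α₀ U) {α₀' : ℝ} (hα' : 0 < α₀') (hα3 : C0 (d + 1) * α₀' ≤ 1 / 3)
    (hα2 : 2 * α₀' ≤ c2' (d + 1) (ℓ + 1)) (hK : Kpl i ((kGeo i).M * α₀) * (kGeo i).L ^ 4 < α₀')
    (Λ : SiteY i → Matrix (Fin N) (Fin N) ℂ) (z : SiteY i) {M : ℝ} (hM : 0 ≤ M)
    (hΛ : ∀ w : SiteY i, blkOf i.D.toDomains w = blkOf i.D.toDomains z → ‖Λ w‖ ≤ M) :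
    ‖(deltaPrimeAY i (parSymY i) U Λ - deltaPrimeAY i (parKnitY i) U Λ) z‖
      ≤ 32 * ((d : ℝ) + 1) ^ 2 * α₀' * ((((ℓ + 1) ^ (blkOf i.D.toDomains z).1.1 : ℕ) : ℝ) ^ 2)⁻¹ * M := by
  set s := blkOf i.D.toDomains z with hsdef
  have hU : ∀ μ x, U μ x ∈ G := fun μ x => mem_of_reg335P (G := G) i hreg μ x
  have hparK : ∀ z w : SiteY i, parKnitY i U z w ∈ unitaryUnits (Matrix (Fin N) (Fin N) ℂ) :=
    fun z w => parKnitY_mem_unitary_of_reg335P i hG1 hGU U hc hMα hreg hα' hα3 hα2 hK z w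
  have hδ0 : 0 ≤ 8 * ((d : ℝ) + 1) ^ 2 * α₀' := by positivity
  have hmain := norm_sub_apply_le_of_blk i U rfl hδ0 (fun w _ => contraction_of_mem_unitary le_rfl (hparK _ _))
    (fun w _ => contraction_of_mem_unitary hGU (parSymY_mem i hU _ _))
    (fun w hw => by
      rw [norm_sub_rev]
      exact norm_parKnitY_sub_parSymY_le_of_reg335P i hG1 hGU hc hMα hreg hα' hα3 hα2 hK hw) hΛ
  refine hmain.trans ?_
  have ha1 : aPrinted ℓ 1 s.1.1 ≤ 1 := B6Prop23KLevelTorusCensus.aPrinted_le_one (by have := i.hℓ; omega) _ (one_le_level i s)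
  have h0 : 0 ≤ 32 * ((d : ℝ) + 1) ^ 2 * α₀' * ((((ℓ + 1) ^ s.1.1 : ℕ) : ℝ) ^ 2)⁻¹ * M := by positivity
  calc 4 * (8 * ((d : ℝ) + 1) ^ 2 * α₀') * (aPrinted ℓ 1 s.1.1 * ((((ℓ + 1) ^ s.1.1 : ℕ) : ℝ) ^ 2)⁻¹) * M
      = 32 * ((d : ℝ) + 1) ^ 2 * α₀' * ((((ℓ + 1) ^ s.1.1 : ℕ) : ℝ) ^ 2)⁻¹ * M * aPrinted ℓ 1 s.1.1 := by ring
    _ ≤ 32 * ((d : ℝ) + 1) ^ 2 * α₀' * ((((ℓ + 1) ^ s.1.1 : ℕ) : ℝ) ^ 2)⁻¹ * M * 1 := mul_le_mul_of_nonneg_left ha1 h0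
    _ = _ := mul_one _

/-! ## §2 The weighted diagonal majorant of `conj b(c·E)` -/

omit [DecidableEq ι] in
/-- ★★ **`conj b(c·E)` ON (3.35) IS BLOCK-DIAGONAL WITH THE LEVEL WEIGHT**: w.r.t. `(z, j) ↦ ιB(Δ(z))` for a section `ιB` of `β`, the realification of
`c·(Δ′_a(U; parSymY) − Δ′_a(U; parKnitY))` has the majorant `𝟙[a = a′]·|c|·32(d+1)²α₀′·(L^{j(a)})⁻²·(M₂Σ_j‖b_j‖)`, `j(a)` the level of the block `a`.
[cite: Balaban1984PropagatorsII, (2.51) p.232; Balaban1985BackgroundPropagators, (3.24) p.394, (3.19) p.393, (3.35) p.396; Balaban1985Averaging, (44) p.24] -/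
theorem hasMajorant_conj_smul_sub_reg335 [Nonempty (Fin N)]
    (hG1 : ∀ u : (Matrix (Fin N) (Fin N) ℂ)ˣ, u ∈ G → ‖(u : Matrix (Fin N) (Fin N) ℂ)‖ ≤ 1) (hGU : G ≤ unitaryUnits (Matrix (Fin N) (Fin N) ℂ))
    {U : CfgY (Matrix (Fin N) (Fin N) ℂ) i} {c₀ α₀ : ℝ} (hc : c₀ ≤ 10) (hMα : 0 ≤ (kGeo i).M * α₀)
    (hreg : (bg9KP (Matrix (Fin N) (Fin N) ℂ) G i).Reg335 c₀ α₀ U) {α₀' : ℝ} (hα' : 0 < α₀') (hα3 : C0 (d + 1) * α₀' ≤ 1 / 3)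
    (hα2 : 2 * α₀' ≤ c2' (d + 1) (ℓ + 1)) (hK : Kpl i ((kGeo i).M * α₀) * (kGeo i).L ^ 4 < α₀')
    (hι : ∀ s, β i.hN i.D i.hk (ιB s) = s)
    {M₂ : ℝ} (hM₂ : 0 ≤ M₂) (hrepr : ∀ (v : Matrix (Fin N) (Fin N) ℂ) (j : ι), |b.repr v j| ≤ M₂ * ‖v‖) (c : ℝ) :
    HasMajorant (g := toB6 (geo9K i) Rr Hp) (fun p : SiteY i × ι => ιB (blkOf i.D.toDomains p.1))
      (conj b (c • (deltaPrimeAY i (parSymY i) U - deltaPrimeAY i (parKnitY i) U).restrictScalars ℝ))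
      (fun a a' : (geo9K i).Site => if a = a' then
        |c| * (32 * ((d : ℝ) + 1) ^ 2 * α₀' * ((((ℓ + 1 : ℕ) : ℝ) ^ lvl i.hN i.D i.hk a) ^ 2)⁻¹) * (M₂ * ∑ j, ‖b j‖) else 0) := by
  have hk1 : 1 ≤ i.k := le_trans (by norm_num) i.hk2
  have hlvl : ∀ z : SiteY i, lvl i.hN i.D i.hk (ιB (blkOf i.D.toDomains z)) = (blkOf i.D.toDomains z).1.1 := fun z => by
    have h := beta_level i.hN i.D i.hk hk1 (ιB (blkOf i.D.toDomains z))
    rw [hι] at h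
    exact h.symm
  refine hasMajorant_conj_of_local' b (g := geo9K i) (Rr := Rr) (H := Hp) (fun z : SiteY i => ιB (blkOf i.D.toDomains z))
    (fun z w : SiteY i => blkOf i.D.toDomains w = blkOf i.D.toDomains z)
    (fun a => |c| * (32 * ((d : ℝ) + 1) ^ 2 * α₀' * ((((ℓ + 1 : ℕ) : ℝ) ^ lvl i.hN i.D i.hk a) ^ 2)⁻¹)) M₂ hM₂ hrepr (fun z w h => congrArg ιB h) _ ?_
  intro f x B hB
  have hB0 : 0 ≤ B := (norm_nonneg _).trans (hB x rfl)
  have hE := norm_deltaPrimeAY_sub_apply_le_of_reg335P i hG1 hGU hc hMα hreg hα' hα3 hα2 hK f x hB0 (fun w hw => hB w hw)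
  rw [LinearMap.smul_apply, Pi.smul_apply, LinearMap.restrictScalars_apply, LinearMap.sub_apply, ← Complex.coe_smul, norm_smul, Complex.norm_real,
    Real.norm_eq_abs, hlvl x]
  have e : ((((ℓ + 1 : ℕ) : ℝ) ^ (blkOf i.D.toDomains x).1.1) ^ 2)⁻¹ = ((((ℓ + 1) ^ (blkOf i.D.toDomains x).1.1 : ℕ) : ℝ) ^ 2)⁻¹ := by push_cast; ring
  rw [e, mul_assoc]
  exact mul_le_mul_of_nonneg_left hE (abs_nonneg c)

omit [DecidableEq ι] in
/-- ★★ **IN PRINT's UNITS** (`c = η⁻²`, `η = etaS i = L^{−k}`, `c_f = Lᵏ`): `conj b(η⁻²(Δ′_S − Δ′_K)) ≺ 𝟙[a = a′]·θ_E·ℓ(a)⁻²`, `θ_E = 32(d+1)²α₀′·M₂Σ_j‖b_j‖` — the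
(52) file's constant diagonal `θ_E·𝟙` with the level weight `ℓ(a)⁻² = (Lᵏ∕L^{j(a)})² ≥ 1` of the local class.
[cite: Balaban1984PropagatorsII, (2.51) p.232, (2.1) p.224; Balaban1985BackgroundPropagators, (3.24) p.394, (3.35) p.396] -/
theorem hasMajorant_conj_smul_sub_print_reg335 [Nonempty (Fin N)]
    (hG1 : ∀ u : (Matrix (Fin N) (Fin N) ℂ)ˣ, u ∈ G → ‖(u : Matrix (Fin N) (Fin N) ℂ)‖ ≤ 1) (hGU : G ≤ unitaryUnits (Matrix (Fin N) (Fin N) ℂ))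
    {U : CfgY (Matrix (Fin N) (Fin N) ℂ) i} {c₀ α₀ : ℝ} (hc : c₀ ≤ 10) (hMα : 0 ≤ (kGeo i).M * α₀)
    (hreg : (bg9KP (Matrix (Fin N) (Fin N) ℂ) G i).Reg335 c₀ α₀ U) {α₀' : ℝ} (hα' : 0 < α₀') (hα3 : C0 (d + 1) * α₀' ≤ 1 / 3)
    (hα2 : 2 * α₀' ≤ c2' (d + 1) (ℓ + 1)) (hK : Kpl i ((kGeo i).M * α₀) * (kGeo i).L ^ 4 < α₀')
    (hι : ∀ s, β i.hN i.D i.hk (ιB s) = s) (hcf : i.cf = (((ℓ + 1 : ℕ) : ℝ)) ^ i.k)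
    {M₂ : ℝ} (hM₂ : 0 ≤ M₂) (hrepr : ∀ (v : Matrix (Fin N) (Fin N) ℂ) (j : ι), |b.repr v j| ≤ M₂ * ‖v‖) :
    HasMajorant (g := toB6 (geo9K i) Rr Hp) (fun p : SiteY i × ι => ιB (blkOf i.D.toDomains p.1))
      (conj b ((etaS i ^ 2)⁻¹ • (deltaPrimeAY i (parSymY i) U - deltaPrimeAY i (parKnitY i) U).restrictScalars ℝ))
      (fun a a' : (geo9K i).Site => if a = a' then (32 * ((d : ℝ) + 1) ^ 2 * α₀' * (M₂ * ∑ j, ‖b j‖)) * ((geo9K i).len a ^ 2)⁻¹ else 0) := by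
  have h := hasMajorant_conj_smul_sub_reg335 i b ιB (Rr := Rr) (Hp := Hp) hG1 hGU hc hMα hreg hα' hα3 hα2 hK hι hM₂ hrepr ((etaS i ^ 2)⁻¹)
  refine hasMajorant_mono (g := toB6 (geo9K i) Rr Hp) _ h fun a a' => ?_
  split_ifs with haa
  · refine le_of_eq ?_
    rw [abs_of_nonneg (inv_nonneg.2 (sq_nonneg _)), geo9K_len_kGeo, len_eq, hcf]
    have hk : B6Prop22KLevelTorusCensusEta.nKT (toKT i) = (ℓ + 1) ^ i.k := rfl
    unfold etaS
    rw [hk]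
    have hL0 : (0 : ℝ) < ((ℓ + 1 : ℕ) : ℝ) := by exact_mod_cast Nat.succ_pos ℓ
    have hpos : (0 : ℝ) < (((ℓ + 1 : ℕ) : ℝ)) ^ i.k := by positivity
    have hpos' : (0 : ℝ) < (((ℓ + 1 : ℕ) : ℝ)) ^ lvl i.hN i.D i.hk a := by positivity
    rw [abs_of_pos hpos]
    push_cast
    field_simp
  · exact le_rfl

omit [DecidableEq ι] in
/-- ★★ **THE OTHER ORIENTATION** `conj b(η⁻²(Δ′_K − Δ′_S)) ≺ 𝟙[a = a′]·θ_E·ℓ(a)⁻²` (a majorant of `T` is one of `−T`) — the shape of p38's `hasMajorant_conj_E`.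
[cite: Balaban1984PropagatorsII, (2.51) p.232; Balaban1985BackgroundPropagators, (3.24) p.394, (3.35) p.396] -/
theorem hasMajorant_conj_E_reg335 [Nonempty (Fin N)]
    (hG1 : ∀ u : (Matrix (Fin N) (Fin N) ℂ)ˣ, u ∈ G → ‖(u : Matrix (Fin N) (Fin N) ℂ)‖ ≤ 1) (hGU : G ≤ unitaryUnits (Matrix (Fin N) (Fin N) ℂ))
    {U : CfgY (Matrix (Fin N) (Fin N) ℂ) i} {c₀ α₀ : ℝ} (hc : c₀ ≤ 10) (hMα : 0 ≤ (kGeo i).M * α₀)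
    (hreg : (bg9KP (Matrix (Fin N) (Fin N) ℂ) G i).Reg335 c₀ α₀ U) {α₀' : ℝ} (hα' : 0 < α₀') (hα3 : C0 (d + 1) * α₀' ≤ 1 / 3)
    (hα2 : 2 * α₀' ≤ c2' (d + 1) (ℓ + 1)) (hK : Kpl i ((kGeo i).M * α₀) * (kGeo i).L ^ 4 < α₀')
    (hι : ∀ s, β i.hN i.D i.hk (ιB s) = s) (hcf : i.cf = (((ℓ + 1 : ℕ) : ℝ)) ^ i.k)
    {M₂ : ℝ} (hM₂ : 0 ≤ M₂) (hrepr : ∀ (v : Matrix (Fin N) (Fin N) ℂ) (j : ι), |b.repr v j| ≤ M₂ * ‖v‖) :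
    HasMajorant (g := toB6 (geo9K i) Rr Hp) (fun p : SiteY i × ι => ιB (blkOf i.D.toDomains p.1))
      (conj b ((etaS i ^ 2)⁻¹ • (deltaPrimeAY i (parKnitY i) U - deltaPrimeAY i (parSymY i) U).restrictScalars ℝ))
      (fun a a' : (geo9K i).Site => if a = a' then (32 * ((d : ℝ) + 1) ^ 2 * α₀' * (M₂ * ∑ j, ‖b j‖)) * ((geo9K i).len a ^ 2)⁻¹ else 0) := by
  have h := hasMajorant_conj_smul_sub_print_reg335 i b ιB (Rr := Rr) (Hp := Hp) hG1 hGU hc hMα hreg hα' hα3 hα2 hK hι hcf hM₂ hrepr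
  have e0 : ((((etaS i ^ 2)⁻¹) • (deltaPrimeAY i (parKnitY i) U - deltaPrimeAY i (parSymY i) U).restrictScalars ℝ :
      Module.End ℝ (SiteY i → Matrix (Fin N) (Fin N) ℂ))) =
      -(((etaS i ^ 2)⁻¹) • (deltaPrimeAY i (parSymY i) U - deltaPrimeAY i (parKnitY i) U).restrictScalars ℝ) := by
    refine LinearMap.ext fun Φ => ?_
    simp only [LinearMap.smul_apply, LinearMap.neg_apply, LinearMap.restrictScalars_apply, LinearMap.sub_apply, ← smul_neg, neg_sub]
  rw [e0, conj_neg]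
  exact hasMajorant_neg (g := toB6 (geo9K i) Rr Hp) _ h

/-! ## §3 ★★★ Thm 3.1 (3.42)₁ at the knit letter on (3.35) -/

/-- ★★★ **[B9] THM 3.1 (3.42)₁ AT PRINT's KNIT LETTER FOR EVERY MEMBER OF THE LOCAL CLASS (3.35)** — file 9's `hasMajorant_conj_GpY_parKnitY_of_parSymY_len` with
[5]'s global (52) replaced by `U ∈ (bg9KP … G i).Reg335 c₀ α₀` (`G ≤ U(N)`, `|u| ≤ 1` on `G`, `c₀ ≤ 10`, `0 ≤ Mα₀`) and the x-free knit numerics `0 < α₀′`,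
`C₀α₀′ ≤ ⅓`, `2α₀′ ≤ c₂′`, `K_pl(Mα₀)L⁴ < α₀′`: from the DISPLAYED (3.42)₁ majorant `A·ℓ(a)²·e^{−δ₀d}` of `conj b(η²G′(U; parSymY))` (w.r.t. `(z, j) ↦ ιB(Δ z)`, `ιB` a
section of `β`), the member's geometry ((2.54), `d(y,y) = 0`, `d ≥ 0`, (2.61)∕(2.63) at `(δ₀, α)`, `(1−α)δ₀ ≥ 0`) and `θc₁(α) < 1`, `θ = 32(d+1)²α₀′·(M₂Σ_j‖b_j‖)·A`:
`conj b(η²G′(U; parKnitY)) ≺ A·c₁(α)(1 − θc₁(α))⁻¹·ℓ(a)²·e^{−(1−α)δ₀d(a,a′)}` — SAME constant and rate as under (52) (the level weight of `E` cancels against the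
`ℓ²` of `G′_S` at the same block).
[cite: Balaban1985BackgroundPropagators, Thm 3.1 (3.42) p.397, (3.19) p.393, (3.35) p.396, Thm 3.7 (3.90) pp.409–410; Balaban1984PropagatorsII, Prop. 2.2 (2.50)–(2.51) p.232, (2.66)–(2.67) p.234; Balaban1985Averaging, (44) p.24, (52)–(53) pp.26–27] -/
theorem hasMajorant_conj_GpY_parKnitY_of_parSymY_reg335 [Nonempty (Fin N)]
    (hG1 : ∀ u : (Matrix (Fin N) (Fin N) ℂ)ˣ, u ∈ G → ‖(u : Matrix (Fin N) (Fin N) ℂ)‖ ≤ 1) (hGU : G ≤ unitaryUnits (Matrix (Fin N) (Fin N) ℂ))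
    {U : CfgY (Matrix (Fin N) (Fin N) ℂ) i} {c₀ α₀ : ℝ} (hc : c₀ ≤ 10) (hMα : 0 ≤ (kGeo i).M * α₀)
    (hreg : (bg9KP (Matrix (Fin N) (Fin N) ℂ) G i).Reg335 c₀ α₀ U) {α₀' : ℝ} (hα' : 0 < α₀') (hα3 : C0 (d + 1) * α₀' ≤ 1 / 3)
    (hα2 : 2 * α₀' ≤ c2' (d + 1) (ℓ + 1)) (hK : Kpl i ((kGeo i).M * α₀) * (kGeo i).L ^ 4 < α₀')
    (hι : ∀ s, β i.hN i.D i.hk (ιB s) = s) (hcf : i.cf = (((ℓ + 1 : ℕ) : ℝ)) ^ i.k)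
    {M₂ : ℝ} (hM₂ : 0 ≤ M₂) (hrepr : ∀ (v : Matrix (Fin N) (Fin N) ℂ) (j : ι), |b.repr v j| ≤ M₂ * ‖v‖)
    (d' : ℕ) {δ₀ α A : ℝ} (hA : 0 ≤ A) (hαδ : 0 ≤ (1 - α) * δ₀) (htri : Triangle254 (toB6 (geo9K i) Rr Hp))
    (hrefl : ∀ y : (geo9K i).Site, (geo9K i).dist y y = 0) (hdnn : ∀ y y' : (geo9K i).Site, 0 ≤ (geo9K i).dist y y')
    (h261 : Ineq261 d' (toB6 (geo9K i) Rr Hp) δ₀ α) (h263 : Ineq263 d' (toB6 (geo9K i) Rr Hp) δ₀ α)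
    (hsmall : (32 * ((d : ℝ) + 1) ^ 2 * α₀' * (M₂ * ∑ j, ‖b j‖) * A) * B6.c1 d' δ₀ α < 1)
    (hGs : HasMajorant (g := toB6 (geo9K i) Rr Hp) (fun p : SiteY i × ι => ιB (blkOf i.D.toDomains p.1))
      (conj b ((etaS i ^ 2) • (GpY i (parSymY i) U).restrictScalars ℝ))
      (fun a a' => A * (geo9K i).len a ^ 2 * Real.exp (-(δ₀ * (geo9K i).dist a a')))) :
    HasMajorant (g := toB6 (geo9K i) Rr Hp) (fun p : SiteY i × ι => ιB (blkOf i.D.toDomains p.1))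
      (conj b ((etaS i ^ 2) • (GpY i (parKnitY i) U).restrictScalars ℝ))
      (fun a a' => A * B6.c1 d' δ₀ α * (1 - (32 * ((d : ℝ) + 1) ^ 2 * α₀' * (M₂ * ∑ j, ‖b j‖) * A) * B6.c1 d' δ₀ α)⁻¹
          * (geo9K i).len a ^ 2 * Real.exp (-((1 - α) * δ₀ * (geo9K i).dist a a'))) := by
  have hU : ∀ μ x, U μ x ∈ G := fun μ x => mem_of_reg335P (G := G) i hreg μ x
  have hparK : ∀ z w : SiteY i, parKnitY i U z w ∈ unitaryUnits (Matrix (Fin N) (Fin N) ℂ) :=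
    fun z w => parKnitY_mem_unitary_of_reg335P i hG1 hGU U hc hMα hreg hα' hα3 hα2 hK z w
  have hUu : ∀ μ x, U μ x ∈ unitaryUnits (Matrix (Fin N) (Fin N) ℂ) := fun μ x => hGU (hU μ x)
  set θE : ℝ := 32 * ((d : ℝ) + 1) ^ 2 * α₀' * (M₂ * ∑ j, ‖b j‖) with hθEdef
  set θ : ℝ := θE * A with hθdef
  have hSb : 0 ≤ ∑ j, ‖b j‖ := Finset.sum_nonneg fun _ _ => norm_nonneg _
  have hθE0 : 0 ≤ θE := by positivity
  have hθ0 : 0 ≤ θ := mul_nonneg hθE0 hA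
  -- the remainder `R′ = conj b(η⁻²E)·conj b(η²G′_sym) ≺ θ·e^{−δ₀d}` — the level weight cancels at the diagonal point
  have hEmaj := hasMajorant_conj_smul_sub_print_reg335 i b ιB (Rr := Rr) (Hp := Hp) hG1 hGU hc hMα hreg hα' hα3 hα2 hK hι hcf hM₂ hrepr
  have hK₂ : ∀ a a' : (geo9K i).Site, 0 ≤ A * (geo9K i).len a ^ 2 * Real.exp (-(δ₀ * (geo9K i).dist a a')) := fun a a' =>
    mul_nonneg (mul_nonneg hA (sq_nonneg _)) (Real.exp_nonneg _)
  have hR : HasMajorant (g := toB6 (geo9K i) Rr Hp) (fun p : SiteY i × ι => ιB (blkOf i.D.toDomains p.1))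
      (conj b ((etaS i ^ 2)⁻¹ • (deltaPrimeAY i (parSymY i) U - deltaPrimeAY i (parKnitY i) U).restrictScalars ℝ)
        * conj b ((etaS i ^ 2) • (GpY i (parSymY i) U).restrictScalars ℝ))
      (fun a a' => θ * Real.exp (-(δ₀ * (geo9K i).dist a a'))) := by
    refine hasMajorant_mono _ (hasMajorant_mul _ hEmaj hGs hK₂) fun a a' => ?_
    have hsum := sum_ite_eq_mul (S := (geo9K i).Site) a (θE * ((geo9K i).len a ^ 2)⁻¹)
      (fun y'' => A * (geo9K i).len y'' ^ 2 * Real.exp (-(δ₀ * (geo9K i).dist y'' a')))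
    refine (le_of_eq hsum).trans (le_of_eq ?_)
    have hl : (geo9K i).len a ^ 2 ≠ 0 := pow_ne_zero 2 (geo9K_len_pos i a).ne'
    calc θE * ((geo9K i).len a ^ 2)⁻¹ * (A * (geo9K i).len a ^ 2 * Real.exp (-(δ₀ * (geo9K i).dist a a')))
        = θE * A * (((geo9K i).len a ^ 2)⁻¹ * (geo9K i).len a ^ 2) * Real.exp (-(δ₀ * (geo9K i).dist a a')) := by ring
      _ = θ * Real.exp (-(δ₀ * (geo9K i).dist a a')) := by rw [inv_mul_cancel₀ hl, mul_one, hθdef]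
  have hfix := conj_fixedPoint i b (le_refl (unitaryUnits (Matrix (Fin N) (Fin N) ℂ))) hUu hparK (etaS_pos i).ne'
  have h := majorant_of_fixedPoint_266 (fun p : SiteY i × ι => ιB (blkOf i.D.toDomains p.1)) d' δ₀ α θ A (fun a => (geo9K i).len a ^ 2) hA
    (fun a => sq_nonneg _) hθ0 hαδ htri hrefl hdnn h261 h263 hsmall hGs hR hfix
  refine hasMajorant_mono _ h fun a a' => le_of_eq ?_
  simp only [hθdef, hθEdef, toB6_dist]

/-! ## §4 ★★★ Thm 3.1 (3.42)₂,₄ (any left factor) at the knit letter on (3.35) -/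

/-- ★★★ **[B9] THM 3.1 (3.42)₂,₄ AT PRINT's KNIT LETTER FOR EVERY MEMBER OF (3.35)** — file 10's `hasMajorant_left_conj_GpY_parKnitY_of_parSymY_len` with (52)
replaced by the local class and the knit numerics (as in §3): for any real-coordinate LEFT FACTOR `D` with the DISPLAYED majorants `A·ℓ²·e^{−δ₀d}` of
`conj b(η²G′(U; parSymY))` and `A₁·W(a)·e^{−δ₀d}` of `D·conj b(η²G′(U; parSymY))` (`W ≥ 0`), `0 ≤ (1−α)δ₀`, `0 ≤ αδ₀`, `θ = 32(d+1)²α₀′·(M₂Σ‖b_j‖)·A`,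
`θc₁(α) < 1`:  `D·conj b(η²G′(U; parKnitY)) ≺ A₁·(1 + c₁(α)·θc₁(α)(1 − θc₁(α))⁻¹)·W(a)·e^{−(1−α)δ₀d(a,a′)}` — SAME constant and rate as under (52).
[cite: Balaban1985BackgroundPropagators, Thm 3.1 (3.42) p.397, (3.19) p.393, (3.35) p.396, (3.90) pp.409–410; Balaban1984PropagatorsII, (2.51) p.232, (2.61) p.234, (2.66)–(2.67) p.234; Balaban1985Averaging, (44) p.24, (52)–(53) pp.26–27] -/
theorem hasMajorant_left_conj_GpY_parKnitY_of_parSymY_reg335 [Nonempty (Fin N)]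
    (hG1 : ∀ u : (Matrix (Fin N) (Fin N) ℂ)ˣ, u ∈ G → ‖(u : Matrix (Fin N) (Fin N) ℂ)‖ ≤ 1) (hGU : G ≤ unitaryUnits (Matrix (Fin N) (Fin N) ℂ))
    {U : CfgY (Matrix (Fin N) (Fin N) ℂ) i} {c₀ α₀ : ℝ} (hc : c₀ ≤ 10) (hMα : 0 ≤ (kGeo i).M * α₀)
    (hreg : (bg9KP (Matrix (Fin N) (Fin N) ℂ) G i).Reg335 c₀ α₀ U) {α₀' : ℝ} (hα' : 0 < α₀') (hα3 : C0 (d + 1) * α₀' ≤ 1 / 3)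
    (hα2 : 2 * α₀' ≤ c2' (d + 1) (ℓ + 1)) (hK : Kpl i ((kGeo i).M * α₀) * (kGeo i).L ^ 4 < α₀')
    (hι : ∀ s, β i.hN i.D i.hk (ιB s) = s) (hcf : i.cf = (((ℓ + 1 : ℕ) : ℝ)) ^ i.k)
    {M₂ : ℝ} (hM₂ : 0 ≤ M₂) (hrepr : ∀ (v : Matrix (Fin N) (Fin N) ℂ) (j : ι), |b.repr v j| ≤ M₂ * ‖v‖)
    (d' : ℕ) {δ₀ α A A₁ : ℝ} {W : (geo9K i).Site → ℝ} (hA : 0 ≤ A) (hA₁ : 0 ≤ A₁) (hW : ∀ y, 0 ≤ W y) (hαδ : 0 ≤ (1 - α) * δ₀)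
    (hαδ' : 0 ≤ α * δ₀) (htri : Triangle254 (toB6 (geo9K i) Rr Hp)) (hrefl : ∀ y : (geo9K i).Site, (geo9K i).dist y y = 0)
    (hdnn : ∀ y y' : (geo9K i).Site, 0 ≤ (geo9K i).dist y y')
    (h261 : Ineq261 d' (toB6 (geo9K i) Rr Hp) δ₀ α) (h263 : Ineq263 d' (toB6 (geo9K i) Rr Hp) δ₀ α)
    {θ : ℝ} (hθ : θ = 32 * ((d : ℝ) + 1) ^ 2 * α₀' * (M₂ * ∑ j, ‖b j‖) * A) (hsmall : θ * B6.c1 d' δ₀ α < 1)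
    (D : Module.End ℝ (SiteY i × ι → ℝ))
    (hGs : HasMajorant (g := toB6 (geo9K i) Rr Hp) (fun p : SiteY i × ι => ιB (blkOf i.D.toDomains p.1))
      (conj b ((etaS i ^ 2) • (GpY i (parSymY i) U).restrictScalars ℝ))
      (fun a a' => A * (geo9K i).len a ^ 2 * Real.exp (-(δ₀ * (geo9K i).dist a a'))))
    (hD : HasMajorant (g := toB6 (geo9K i) Rr Hp) (fun p : SiteY i × ι => ιB (blkOf i.D.toDomains p.1))
      (D * conj b ((etaS i ^ 2) • (GpY i (parSymY i) U).restrictScalars ℝ))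
      (fun a a' => A₁ * W a * Real.exp (-(δ₀ * (geo9K i).dist a a')))) :
    HasMajorant (g := toB6 (geo9K i) Rr Hp) (fun p : SiteY i × ι => ιB (blkOf i.D.toDomains p.1))
      (D * conj b ((etaS i ^ 2) • (GpY i (parKnitY i) U).restrictScalars ℝ))
      (fun a a' => A₁ * (1 + B6.c1 d' δ₀ α * (θ * B6.c1 d' δ₀ α * (1 - θ * B6.c1 d' δ₀ α)⁻¹)) * W a
        * Real.exp (-((1 - α) * δ₀ * (geo9K i).dist a a'))) := by
  have hU : ∀ μ x, U μ x ∈ G := fun μ x => mem_of_reg335P (G := G) i hreg μ x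
  have hparK : ∀ z w : SiteY i, parKnitY i U z w ∈ unitaryUnits (Matrix (Fin N) (Fin N) ℂ) :=
    fun z w => parKnitY_mem_unitary_of_reg335P i hG1 hGU U hc hMα hreg hα' hα3 hα2 hK z w
  have hUu : ∀ μ x, U μ x ∈ unitaryUnits (Matrix (Fin N) (Fin N) ℂ) := fun μ x => hGU (hU μ x)
  set θE : ℝ := 32 * ((d : ℝ) + 1) ^ 2 * α₀' * (M₂ * ∑ j, ‖b j‖) with hθEdef
  set c₁ : ℝ := B6.c1 d' δ₀ α with hc₁def
  have hSb : 0 ≤ ∑ j, ‖b j‖ := Finset.sum_nonneg fun _ _ => norm_nonneg _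
  have hθE0 : 0 ≤ θE := by positivity
  have hc₁0 : 0 ≤ c₁ := c1_nonneg d' δ₀ α
  have hθ0 : 0 ≤ θ := by rw [hθ]; positivity
  have hq0 : 0 ≤ (1 - θ * c₁)⁻¹ := inv_nonneg.2 (by rw [hc₁def]; linarith)
  -- §3: the majorant of `conj b(η²G′_knit)`
  have hGk := hasMajorant_conj_GpY_parKnitY_of_parSymY_reg335 i b ιB (Rr := Rr) (Hp := Hp) hG1 hGU hc hMα hreg hα' hα3 hα2 hK hι hcf hM₂ hrepr d' hA hαδ
    htri hrefl hdnn h261 h263 (by rw [← hθEdef, ← hθ]; exact hsmall) hGs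
  rw [← hθEdef, ← hθ] at hGk
  -- the bracket `T = conj b(η⁻²E)·conj b(η²G′_knit) ≺ r·e^{−(1−α)δ₀d}`, `r = θc₁(1 − θc₁)⁻¹`
  set r : ℝ := θ * c₁ * (1 - θ * c₁)⁻¹ with hrdef
  have hr0 : 0 ≤ r := by positivity
  have hEmaj := hasMajorant_conj_smul_sub_print_reg335 i b ιB (Rr := Rr) (Hp := Hp) hG1 hGU hc hMα hreg hα' hα3 hα2 hK hι hcf hM₂ hrepr
  rw [← hθEdef] at hEmaj
  have hK₂ : ∀ a a' : (geo9K i).Site, 0 ≤ A * B6.c1 d' δ₀ α * (1 - θ * B6.c1 d' δ₀ α)⁻¹ * (geo9K i).len a ^ 2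
      * Real.exp (-((1 - α) * δ₀ * (geo9K i).dist a a')) :=
    fun a a' => mul_nonneg (mul_nonneg (mul_nonneg (mul_nonneg hA hc₁0) hq0) (sq_nonneg _)) (Real.exp_nonneg _)
  have hT : HasMajorant (g := toB6 (geo9K i) Rr Hp) (fun p : SiteY i × ι => ιB (blkOf i.D.toDomains p.1))
      (conj b ((etaS i ^ 2)⁻¹ • (deltaPrimeAY i (parSymY i) U - deltaPrimeAY i (parKnitY i) U).restrictScalars ℝ)
        * conj b ((etaS i ^ 2) • (GpY i (parKnitY i) U).restrictScalars ℝ))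
      (fun a a' => r * Real.exp (-((1 - α) * δ₀ * (geo9K i).dist a a'))) := by
    refine hasMajorant_mono _ (hasMajorant_mul _ hEmaj hGk hK₂) fun a a' => ?_
    have hsum := sum_ite_eq_mul (S := (geo9K i).Site) a (θE * ((geo9K i).len a ^ 2)⁻¹)
      (fun y'' => A * B6.c1 d' δ₀ α * (1 - θ * B6.c1 d' δ₀ α)⁻¹ * (geo9K i).len y'' ^ 2 * Real.exp (-((1 - α) * δ₀ * (geo9K i).dist y'' a')))
    refine (le_of_eq hsum).trans (le_of_eq ?_)
    have hl : (geo9K i).len a ^ 2 ≠ 0 := pow_ne_zero 2 (geo9K_len_pos i a).ne'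
    calc θE * ((geo9K i).len a ^ 2)⁻¹
          * (A * B6.c1 d' δ₀ α * (1 - θ * B6.c1 d' δ₀ α)⁻¹ * (geo9K i).len a ^ 2 * Real.exp (-((1 - α) * δ₀ * (geo9K i).dist a a')))
        = θE * A * B6.c1 d' δ₀ α * (1 - θ * B6.c1 d' δ₀ α)⁻¹ * (((geo9K i).len a ^ 2)⁻¹ * (geo9K i).len a ^ 2)
          * Real.exp (-((1 - α) * δ₀ * (geo9K i).dist a a')) := by ring
      _ = r * Real.exp (-((1 - α) * δ₀ * (geo9K i).dist a a')) := by rw [inv_mul_cancel₀ hl, mul_one, hrdef, hθ, hc₁def]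
  -- compose with the displayed left entry ([4] (2.61) + (2.54): one factor `c₁`)
  have hDT := majorant_G0_mul_265 (g := toB6 (geo9K i) Rr Hp) (fun p : SiteY i × ι => ιB (blkOf i.D.toDomains p.1)) d' δ₀ α A₁ r W hA₁ hW hr0 hαδ
    htri h261 hD hT
  have hD' : HasMajorant (g := toB6 (geo9K i) Rr Hp) (fun p : SiteY i × ι => ιB (blkOf i.D.toDomains p.1))
      (D * conj b ((etaS i ^ 2) • (GpY i (parSymY i) U).restrictScalars ℝ))
      (fun a a' => A₁ * W a * Real.exp (-((1 - α) * δ₀ * (geo9K i).dist a a'))) := by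
    refine hasMajorant_mono _ hD fun a a' => mul_le_mul_of_nonneg_left (Real.exp_le_exp.2 ?_) (mul_nonneg hA₁ (hW a))
    have := mul_nonneg hαδ' (hdnn a a')
    nlinarith
  have hsum := hasMajorant_add _ hD' hDT
  rw [left_conj_identity i b (le_refl (unitaryUnits (Matrix (Fin N) (Fin N) ℂ))) hUu hparK (etaS_pos i).ne' D]
  refine hasMajorant_mono _ hsum fun a a' => le_of_eq ?_
  simp only [hc₁def, toB6_dist]
  ring

end Literature.MathematicalPhysics.QuantumFieldTheory.Balaban1983to89.B9B8KnitLetterTransferReg335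

end
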